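import Mathlib
import HarnessLib
import Summits.HubbardSuperconductivity.HubbardSuperconductivity.Theorems.KLProgrammeKLRegimeSplitBundleV6

/-!
# Route `KLProgramme` — crux K3 `KLRegimeTwoPointLimit` (stmt-HubbardSuperconductivity-19937), the two-leg slot: clause (E3g)
# `TwoLegAngularG` — ANGULAR REGULARITY of the scale-`n` local part on the frame's own Fermi curve (defect Δ18, seat hubbard-kl-k3c3-p3,
# cell gate-hubbard-kl STATUS 2026-08-26T17:08Z; text offered to the typing authority for the gen-3/gen-4 bundle)

WHY (Δ18, HOME/hubbard-kl-k3c3-p3/DEFECT-ANGULAR.md).  The renormalisation predicate `RenormalisedAtF … K R n` and the conclusion of child 2's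
one-volume construction `CtOneVolume` bound the local part `θ ↦ ν_n(K)(θ) = klLocalPart L M β U μ K n θ` at EVERY real angle, while every
clause of the V6/V7/V8 two-leg slot reads that profile only at the finite set of LATTICE ANGLES `momentumAngle L k` and through its angular
mean (`klFrameExtG_congr`, `…CountertermAngularReading` §1), through shell lattice angles (`TwoLegSlopes`) or through volume DIFFERENCES
(`TwoLegVolumeRate`).  Between lattice angles nothing is asserted, so neither the antecedents `RenormalisedAtF … j` nor `CtOneVolume` are
certifiable by a child-2 prover (re-deriving the angular regularity of `Re Σ_n` = re-running the engine; the Δ14 class).  The cure is one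
more ENGINE-OUTPUT conjunct, the angular analogue of (E3a)'s sizes stated on the TRUE profile instead of on its interpolant:

* (E3g) `TwoLegAngularG G Q R β U μ K n`: `θ ↦ ν_n(K)(θ)` is `C⁴` and its angular derivatives of orders `1 ≤ j ≤ 4` are bounded by the
  VOLUME-UNIFORM majorant `angBar G Q R U (nScales β) j` (§1).  In BGM 2006's analysis this is the k-regularity of the quadratic kernel
  read along the curve ((2.36), (2.40): `O(U²)` derivative constants per scale, sector-angle losses `4^{(j−2)⁺m}` at scale `m`) plus the
  frame's own value `K(k_F(θ))` (`O(Gfr·U)`, chain rule through the implicit curve `k_F`, whose derivatives up to order 4 carry the frame's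
  `‖DʲK‖ ≤ Σ_m Gfr_j·U²·4^{(j−2)m}`); the majorant below is deliberately generous — polynomial in the constants, linear in `|U|`,
  `4^{j(N+1)}` in the frame-class index `N = nScales β`, numeral `klAngKappa^(j+1)` for the free-band ray geometry on `klWindowC` and the
  Faà di Bruno combinatorics — because child 2 needs ONLY that it is finite and independent of the volume `(L, M)`: the construction
  volume `L₀` is chosen after `(β, U)` and the hypothesis block.
* `TwoLegStepGA hist … := TwoLegStepG hist … ∧ TwoLegAngularG …` — the shape in which a bundle's two-leg slot (and the (E3f)
  comparison-volume antecedent) would carry it: `TwoLegStepV9 := TwoLegStepGA histV9 ∧ TwoLegVolumeRate (histV9 ∧ TwoLegStepGA histV9)`.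

How child 2 consumes it: lattice-angle control (fixed point) + «every direction is within `cA/L` of a flat-tube lattice angle» +
`TwoLegAngularG.abs_sub_le` ⇒ every angle (`…CountertermAngularReading.abs_le_of_net_of_deriv`); the off-lattice wiggle of the normal-form
frames is an interpolation error `O_{β,U}(L₀^{-2})` from the `C⁴` profiles.  Definitions + bookkeeping lemmas only; nothing is asserted
about the Hubbard model.  References: BGM 2006 [arXiv:cond-mat/0507686] §2.3–2.4; FST, CPAM 53 (2000) 1350 (the counterterm as a `C²`
function on the Fermi surface); HOME/hubbard-kl-k3c3-p3/DEFECT-ANGULAR.md.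
-/

noncomputable section

namespace Summit.HubbardSuperconductivity.HubbardSuperconductivity.Theorems.KLRegimeSplit

set_option linter.dupNamespace false -- summit = problem name (single-conjunct summit), D-0017

open Real Finset
open Literature.MathematicalPhysics.QuantumLattice Literature.Probability.LatticeModels
open Summit.HubbardSuperconductivity.HubbardSuperconductivity.Theorems.KLProgrammeLegKernels

/-! ## §1 The angular majorant -/

/-- The numeral of (E3g): absorbs the ray geometry of the free band on `klWindowC` (`|k_F^{(i)}(θ)|`, `i ≤ 4`, through `u ≤ π√2` and the
radial transversality of the band) and the chain-rule combinatorics up to order 4.  FIXED: `4096` (read with the power `j + 1`). -/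
def klAngKappa : ℝ := 4096

/-- The constant content of the angular majorant: one plus the sum over orders `i ≤ 4` of the frame allowances `R.Gfr i` and the two-leg
sizes `G.S i + Q.S' i·|U|` (every derivative of the frame and of the accumulated two-leg value that the chain rule can meet). -/
def angConst (G : GeoConsts) (Q : EngConsts) (R : RenConsts) (U : ℝ) : ℝ :=
  1 + ∑ i ∈ range 5, (R.Gfr i + G.S i + Q.S' i * |U|)

/-- **(E3g) majorant** of the order-`j` angular derivative of the scale-`n` local part of a frame of class `N`:
`angBar G Q R U N j = klAngKappa^(j+1) · (angConst G Q R U)^j · |U| · 4^{j(N+1)}` — volume-free, scale-free in `n ≤ N`, generous. -/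
def angBar (G : GeoConsts) (Q : EngConsts) (R : RenConsts) (U : ℝ) (N j : ℕ) : ℝ :=
  klAngKappa ^ (j + 1) * angConst G Q R U ^ j * |U| * (4 : ℝ) ^ (j * (N + 1))

/-! ## §2 The clause -/

section Model

variable (L M : ℕ) [NeZero L] [NeZero M]

/-- **(E3g) `TwoLegAngularG G Q R … K n`** — ANGULAR REGULARITY of the scale-`n` local part read on the frame's own Fermi curve: the profile
`θ ↦ ν_n(K)(θ) = klLocalPart L M β U μ K n θ` is `C⁴` and, for `1 ≤ j ≤ 4` and every angle,
`|∂_θ^j ν_n(K)(θ)| ≤ angBar G Q R U (nScales β) j` — uniformly in the volume `(L, M)`.  ENGINE OUTPUT (the k-regularity of `Re Σ_n` along the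
curve and of the frame's own value there); child 2's input for reading the renormalisation condition BETWEEN lattice angles (Δ18). -/
def TwoLegAngularG (G : GeoConsts) (Q : EngConsts) (R : RenConsts) (β U μ : ℝ) (K : TrigPolyC4v) (n : ℕ) : Prop :=
  ContDiff ℝ 4 (klLocalPart L M β U μ K n) ∧
    ∀ j : ℕ, 1 ≤ j → j ≤ 4 → ∀ θ : ℝ, |iteratedDeriv j (klLocalPart L M β U μ K n) θ| ≤ angBar G Q R U (nScales β) j

/-- **`TwoLegStepGA hist G P Q R … K n`** := `TwoLegStepG hist … ∧ TwoLegAngularG …` — the «G» two-leg step (two-tier sizes, floor,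
frame-Lipschitz, slopes) together with (E3g); the shape a bundle's two-leg slot and its (E3f) comparison-volume antecedent would carry. -/
def TwoLegStepGA (hist : TrigPolyC4v → ℕ → Prop) (G : GeoConsts) (P : SplitConsts) (Q : EngConsts) (R : RenConsts)
    (β U μ : ℝ) (K : TrigPolyC4v) (n : ℕ) : Prop :=
  TwoLegStepG L M hist G P Q R β U μ K n ∧ TwoLegAngularG L M G Q R β U μ K n

end Model

/-! ## §3 Bookkeeping -/

/-- `0 < klAngKappa`. -/
theorem klAngKappa_pos : 0 < klAngKappa := by norm_num [klAngKappa]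

/-- The constant content is `≥ 1` for well-formed constants. -/
theorem one_le_angConst {G : GeoConsts} {Q : EngConsts} {R : RenConsts} (hG : G.WF) (hQ : Q.WF) (hR : R.WF) (U : ℝ) :
    1 ≤ angConst G Q R U := by
  unfold angConst
  have hS : ∀ j, 0 ≤ G.S j := hG.2.2.2.2.2.2.2.2.2.2.2.2.2.2.2.2.2.1
  have hS' : ∀ j, 0 ≤ Q.S' j := hQ.2.2.2.2.1
  have hGfr : ∀ j, 0 ≤ R.Gfr j := hR.2.2
  have : 0 ≤ ∑ i ∈ range 5, (R.Gfr i + G.S i + Q.S' i * |U|) :=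
    sum_nonneg fun i _ => by have := hS i; have := hS' i; have := hGfr i; positivity
  linarith

/-- The angular majorant is nonnegative for well-formed constants. -/
theorem angBar_nonneg {G : GeoConsts} {Q : EngConsts} {R : RenConsts} (hG : G.WF) (hQ : Q.WF) (hR : R.WF) (U : ℝ) (N j : ℕ) :
    0 ≤ angBar G Q R U N j := by
  unfold angBar
  have h1 := one_le_angConst hG hQ hR U
  have hκ := klAngKappa_pos
  have : 0 ≤ angConst G Q R U := by linarith
  positivity

section Model

variable {L M : ℕ} [NeZero L] [NeZero M]

/-- (E3g) gives the «G» step back. -/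
theorem TwoLegStepGA.step {hist : TrigPolyC4v → ℕ → Prop} {G : GeoConsts} {P : SplitConsts} {Q : EngConsts} {R : RenConsts}
    {β U μ : ℝ} {K : TrigPolyC4v} {n : ℕ} (h : TwoLegStepGA L M hist G P Q R β U μ K n) :
    TwoLegStepG L M hist G P Q R β U μ K n := h.1

/-- (E3g) from the augmented step. -/
theorem TwoLegStepGA.angular {hist : TrigPolyC4v → ℕ → Prop} {G : GeoConsts} {P : SplitConsts} {Q : EngConsts} {R : RenConsts}
    {β U μ : ℝ} {K : TrigPolyC4v} {n : ℕ} (h : TwoLegStepGA L M hist G P Q R β U μ K n) :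
    TwoLegAngularG L M G Q R β U μ K n := h.2

/-- **The first-order content of (E3g): the local part is differentiable with `|∂_θ ν_n| ≤ angBar … 1`.** -/
theorem TwoLegAngularG.abs_deriv_le {G : GeoConsts} {Q : EngConsts} {R : RenConsts} {β U μ : ℝ} {K : TrigPolyC4v} {n : ℕ}
    (h : TwoLegAngularG L M G Q R β U μ K n) (θ : ℝ) :
    |deriv (klLocalPart L M β U μ K n) θ| ≤ angBar G Q R U (nScales β) 1 := by
  have := h.2 1 le_rfl (by norm_num) θ
  simpa [iteratedDeriv_one] using this

/-- (E3g) makes the local part differentiable in the angle. -/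
theorem TwoLegAngularG.differentiable {G : GeoConsts} {Q : EngConsts} {R : RenConsts} {β U μ : ℝ} {K : TrigPolyC4v} {n : ℕ}
    (h : TwoLegAngularG L M G Q R β U μ K n) : Differentiable ℝ (klLocalPart L M β U μ K n) :=
  h.1.differentiable (by norm_num)

/-- **The angular modulus child 2 reads**: under (E3g), `|ν_n(K)(θ) − ν_n(K)(θ′)| ≤ angBar … 1 · |θ − θ′|` (mean value inequality). -/
theorem TwoLegAngularG.abs_sub_le {G : GeoConsts} {Q : EngConsts} {R : RenConsts} {β U μ : ℝ} {K : TrigPolyC4v} {n : ℕ}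
    (h : TwoLegAngularG L M G Q R β U μ K n) (θ θ' : ℝ) :
    |klLocalPart L M β U μ K n θ - klLocalPart L M β U μ K n θ'| ≤ angBar G Q R U (nScales β) 1 * |θ - θ'| := by
  have hΛ : 0 ≤ angBar G Q R U (nScales β) 1 := (abs_nonneg _).trans (h.abs_deriv_le 0)
  have hlipW : LipschitzWith (Real.toNNReal (angBar G Q R U (nScales β) 1)) (klLocalPart L M β U μ K n) := by
    refine lipschitzWith_of_nnnorm_deriv_le h.differentiable fun x => ?_
    have hx := h.abs_deriv_le x
    rw [← Real.norm_eq_abs] at hx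
    rw [← NNReal.coe_le_coe, coe_nnnorm, Real.coe_toNNReal _ hΛ]
    exact hx
  have := hlipW.dist_le_mul θ θ'
  rw [Real.dist_eq, Real.dist_eq, Real.coe_toNNReal _ hΛ] at this
  exact this

/-- **Every angle from a net of angles, under (E3g)**: if `|ν_n(K)| ≤ A` on a set `S` of angles meeting every `δ`-window, then
`|ν_n(K)(θ)| ≤ A + angBar … 1 · δ` for every `θ` — the form in which child 2 passes from lattice angles to `RenormalisedAtF`. -/
theorem TwoLegAngularG.abs_le_of_net {G : GeoConsts} {Q : EngConsts} {R : RenConsts} {β U μ : ℝ} {K : TrigPolyC4v} {n : ℕ}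
    (h : TwoLegAngularG L M G Q R β U μ K n) {S : Set ℝ} {A δ : ℝ}
    (hS : ∀ a ∈ S, |klLocalPart L M β U μ K n a| ≤ A) (hnet : ∀ θ : ℝ, ∃ a ∈ S, |θ - a| ≤ δ) (θ : ℝ) :
    |klLocalPart L M β U μ K n θ| ≤ A + angBar G Q R U (nScales β) 1 * δ := by
  have hΛ : 0 ≤ angBar G Q R U (nScales β) 1 := (abs_nonneg _).trans (h.abs_deriv_le 0)
  obtain ⟨a, haS, ha⟩ := hnet θ
  have h1 : |klLocalPart L M β U μ K n θ - klLocalPart L M β U μ K n a| ≤ angBar G Q R U (nScales β) 1 * δ :=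
    (h.abs_sub_le θ a).trans (mul_le_mul_of_nonneg_left ha hΛ)
  have h2 : |klLocalPart L M β U μ K n θ| ≤
      |klLocalPart L M β U μ K n a| + |klLocalPart L M β U μ K n θ - klLocalPart L M β U μ K n a| := by
    have := abs_add_le (klLocalPart L M β U μ K n a) (klLocalPart L M β U μ K n θ - klLocalPart L M β U μ K n a)
    simpa [add_sub_cancel] using this
  linarith [hS a haS]

end Model

end Summit.HubbardSuperconductivity.HubbardSuperconductivity.Theorems.KLRegimeSplit

end
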